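import Mathlib.Topology.Algebra.Group.Matrix
import Mathlib.LinearAlgebra.Matrix.SpecialLinearGroup
import Literature.NumberTheory.Automorphic.QuaternionicFormsClassNumber
import HarnessLib

/-!
# Strong approximation for `SL₂`: `SL₂(K)` is dense in `SL₂(𝔸_K^∞)`

Topic `NumberTheory/Automorphic`. For a Dedekind domain `R` with fraction field `K` (e.g. the
ring of integers of a number field) we PROVE the strong approximation theorem for `SL₂` with
respect to the finite adeles:

* `Literature.NumberTheory.Automorphic.denseRange_specialLinearGroup_map_finiteAdeleRing`: the diagonal image of
  `SL₂(K)` is dense in `SL₂(𝔸_K^∞)` (`𝔸_K^∞ = FiniteAdeleRing R K`, Mathlib's restricted product,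
  with Mathlib's topology on `SL(2, ·)` of `Mathlib.Topology.Algebra.Group.Matrix`);
* `Literature.NumberTheory.Automorphic.exists_specialLinearGroup_map_mul_eq`: consequently
  `SL₂(𝔸_K^∞) = SL₂(K) · U` for every open subgroup `U`, i.e. every `g ∈ SL₂(𝔸_K^∞)` is `γ u` with
  `γ ∈ SL₂(K)`, `u ∈ U` (the form used to adelise classical modular forms: Gelbart (1975), (3.1);
  Bump (1997), Thm. 3.3.1, whose `GL₂`-version over `ℚ` follows from this and
  `𝔸_ℚ^{∞,×} = ℚ_{>0}^× Ẑ^×`).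

This is the simplest case of the strong approximation theorem of Kneser and Platonov
(Platonov–Rapinchuk, *Algebraic groups and number theory* (1994), Thm. 7.12: `G(K)` is dense in
`G(𝔸_K^S)` for `G` simply connected absolutely almost simple and `G_S` non-compact); for `SL_n`
it goes back to Eichler and Kneser.

## Proof

Not the printed proofs (which use either the local–global structure of `SL₂(𝔸)` as a restricted
product of the `SL₂(K_v)` or, for `ℚ`, the surjectivity of `SL₂(ℤ) → SL₂(ℤ/N)`), but a direct
argument on the restricted product ring `A = 𝔸_K^∞` which avoids local embeddings altogether:

1. (`transvection_mem_topologicalClosure_range`) The closure `H` of the image of `SL₂(K)` is a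
   closed subgroup containing all elementary unipotents `u⁺(x) = (1 x; 0 1)`, `u⁻(x) = (1 0; x 1)`,
   `x ∈ A`: `x ↦ u^±(x)` is continuous, `u^±(K) ⊆ SL₂(K)` and `K` is dense in `A` (strong
   approximation for the additive group, `denseRange_algebraMap_finiteAdeleRing` of
   `QuaternionicFormsClassNumber`).
2. (`SpecialLinearGroup.mem_of_isUnit_apply`, any commutative ring) If the upper left entry `α` of
   `g ∈ SL₂(A)` is a unit then `g` is a product of nine elementary unipotents:
   `g = u⁻(γα⁻¹) · w(α) w(-1) · u⁺(α⁻¹β)` with `w(a) = u⁺(a) u⁻(-a⁻¹) u⁺(a)` and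
   `w(α) w(-1) = diag(α, α⁻¹)` (Whitehead's lemma).
3. (`FiniteAdeleRing.exists_isUnit_add_mul`) For every `g = (a b; c d) ∈ SL₂(A)` there is
   `t ∈ A` with `a + tc ∈ Aˣ` — chosen place by place: `t_v = 0` if `c_v = 0` or if `a_v` is a
   `v`-unit and `c_v` is `v`-integral, and `t_v = (1 - a_v)/c_v` otherwise; at the almost all `v`
   where `g_v` is integral, `a_v d_v - b_v c_v = 1` forces `a_v` or `c_v` to be a `v`-unit, so
   `t` is a finite adele and `a + tc` is a unit by Mathlib's `FiniteAdeleRing.isUnit_iff`. Then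
   `u⁺(t) g` has unit upper left entry, so `g ∈ H` by 1 and 2, `H = SL₂(A)`.

## References

* V. Platonov, A. Rapinchuk, *Algebraic groups and number theory*, Academic Press (1994),
  §7.4, Thm. 7.12 [PlatonovRapinchuk1994].
* D. Bump, *Automorphic forms and representations* (1997), Thm. 3.3.1 [Bump1997].
* S. Gelbart, *Automorphic forms on adele groups* (1975), §3.A, (3.1) [Gelbart1975].
-/

noncomputable section

open Matrix
open scoped MatrixGroups

namespace Matrix.SpecialLinearGroup

/-! ### Elementary unipotents generate the matrices with a unit entry (any commutative ring) -/

section Elementary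

variable {A B : Type*} [CommRing A] [CommRing B]

/-- `SpecialLinearGroup.map` of a transvection is the transvection of the image
(functoriality of `1 + c E_{ij}`). Deliberate dot-notation extension of Mathlib's
`Matrix.SpecialLinearGroup`. [folklore] -/
theorem map_transvection {ι : Type*} [DecidableEq ι] [Fintype ι] (f : A →+* B) {i j : ι}
    (hij : i ≠ j) (c : A) : map f (transvection hij c) = transvection hij (f c) := by
  refine Subtype.ext ?_
  rw [map_apply_coe, transvection_coe, transvection_coe]
  ext k l
  simp only [RingHom.mapMatrix_apply, map_apply, add_apply, one_apply, single_apply]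
  split_ifs <;> simp

/-- The upper left entry of `u⁺(t) g` is `g₀₀ + t g₁₀` (a row operation). [folklore] -/
theorem transvection_mul_apply_zero_zero (t : A) (g : SL(2, A)) :
    (transvection (show (0 : Fin 2) ≠ 1 by decide) t * g) 0 0 = g 0 0 + t * g 1 0 := by
  rw [coe_mul, transvection_coe, add_mul, one_mul]
  simp [Matrix.mul_apply, single_apply]

/-- **Whitehead's lemma, `2 × 2`.** If the upper left entry of `g ∈ SL₂(A)` (`A` any commutative
ring) is a unit `α`, then `g` lies in every subgroup containing all elementary unipotents
`u⁺(x) = (1 x; 0 1)` and `u⁻(x) = (1 0; x 1)`: explicitly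
`g = u⁻(γα⁻¹) · [u⁺(α) u⁻(-α⁻¹) u⁺(α)] [u⁺(-1) u⁻(1) u⁺(-1)] · u⁺(α⁻¹β)`, the bracketed products
being `w(α) = (0 α; -α⁻¹ 0)` and `w(-1)`, with `w(α) w(-1) = diag(α, α⁻¹)` (compare Mathlib's
`Matrix.SpecialLinearGroup.SL2.transvection_induction` for fields). [folklore] -/
theorem mem_of_isUnit_apply (H : Subgroup SL(2, A))
    (hu : ∀ x : A, transvection (show (0 : Fin 2) ≠ 1 by decide) x ∈ H)
    (hl : ∀ x : A, transvection (show (1 : Fin 2) ≠ 0 by decide) x ∈ H)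
    (g : SL(2, A)) (hg : IsUnit (g 0 0)) : g ∈ H := by
  obtain ⟨e, he⟩ := hg.exists_right_inv
  have h01 : (0 : Fin 2) ≠ 1 := by decide
  have h10 : (1 : Fin 2) ≠ 0 := by decide
  have hdet : g 0 0 * g 1 1 - g 0 1 * g 1 0 = 1 := by
    have := g.2
    rw [Matrix.det_fin_two] at this
    exact this
  -- Gaussian elimination with the unit pivot `g₀₀`: `u⁻(-c e) g u⁺(-e b) = diag(g₀₀, e)`, and
  -- Whitehead's lemma `diag(a, e) = w(a) w(-1)`, `w(a) = u⁺(a) u⁻(-e) u⁺(a)`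
  have hEq : transvection h10 (-(g 1 0 * e)) * g * transvection h01 (-(e * g 0 1)) =
      transvection h01 (g 0 0) * transvection h10 (-e) * transvection h01 (g 0 0) *
        (transvection h01 (-1 : A) * transvection h10 (1 : A) * transvection h01 (-1 : A)) := by
    refine Subtype.ext ?_
    simp only [coe_mul, transvection_coe]
    ext i j
    fin_cases i <;> fin_cases j <;>
      simp [Matrix.mul_apply, Fin.sum_univ_two, Matrix.single_apply]
    · linear_combination (-(g 0 0)) * he
    · linear_combination (-(g 0 1 + 1)) * he
    · linear_combination (1 - g 1 0) * he
    · linear_combination (g 0 1 * g 1 0 * e - g 1 1) * he + e * hdet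
  have hmem : transvection h01 (g 0 0) * transvection h10 (-e) * transvection h01 (g 0 0) *
      (transvection h01 (-1 : A) * transvection h10 (1 : A) * transvection h01 (-1 : A)) ∈ H :=
    H.mul_mem (H.mul_mem (H.mul_mem (hu _) (hl _)) (hu _))
      (H.mul_mem (H.mul_mem (hu _) (hl _)) (hu _))
  rw [← hEq] at hmem
  have h1 := H.mul_mem (H.inv_mem (hl (-(g 1 0 * e)))) hmem
  rw [← mul_assoc, ← mul_assoc, inv_mul_cancel, one_mul] at h1
  have h2 := H.mul_mem h1 (H.inv_mem (hu (-(e * g 0 1))))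
  rwa [mul_assoc, mul_inv_cancel, mul_one] at h2

/-- If `g₀₀ + t g₁₀` is a unit for some `t`, then `g ∈ SL₂(A)` lies in every subgroup containing
the elementary unipotents (`g = u⁺(-t) (u⁺(t) g)` and `mem_of_isUnit_apply`). [folklore] -/
theorem mem_of_isUnit_apply_add_mul (H : Subgroup SL(2, A))
    (hu : ∀ x : A, transvection (show (0 : Fin 2) ≠ 1 by decide) x ∈ H)
    (hl : ∀ x : A, transvection (show (1 : Fin 2) ≠ 0 by decide) x ∈ H)
    (g : SL(2, A)) {t : A} (hg : IsUnit (g 0 0 + t * g 1 0)) : g ∈ H := by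
  have h01 : (0 : Fin 2) ≠ 1 := by decide
  have hg' : transvection h01 t * g ∈ H := by
    refine mem_of_isUnit_apply H hu hl _ ?_
    rwa [transvection_mul_apply_zero_zero]
  have := H.mul_mem (H.inv_mem (hu t)) hg'
  rwa [inv_mul_cancel_left] at this

end Elementary

/-! ### Continuity of the elementary unipotents -/

section Topology

variable {A : Type*} [CommRing A] [TopologicalSpace A] [IsTopologicalRing A]

/-- `x ↦ 1 + x E_{ij}` is continuous into `SL(n, A)` (entries are continuous). [folklore] -/
theorem continuous_transvection {ι : Type*} [DecidableEq ι] [Fintype ι] {i j : ι} (hij : i ≠ j) :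
    Continuous fun x : A => transvection hij x := by
  refine continuous_induced_rng.2 ?_
  change Continuous fun x : A => ((transvection hij x : SpecialLinearGroup ι A) : Matrix ι ι A)
  simp_rw [transvection_coe]
  refine continuous_const.add (continuous_matrix fun k l => ?_)
  simp only [single_apply]
  split_ifs
  · exact continuous_id
  · exact continuous_const

end Topology

end Matrix.SpecialLinearGroup

namespace Literature.NumberTheory.Automorphic

open IsDedekindDomain IsDedekindDomain.HeightOneSpectrum Matrix.SpecialLinearGroup

/-! ### The adelic input: making the upper left entry a unit -/

section Adelic

variable {R : Type*} [CommRing R] [IsDedekindDomain R] {K : Type*} [Field K] [Algebra R K]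
  [IsFractionRing R K]

/-- **Row reduction over the finite adeles.** For `a, b, c, d ∈ 𝔸_K^∞` with `ad - bc = 1` there
is `t ∈ 𝔸_K^∞` with `a + tc` a unit: place by place, `t_v = 0` if `c_v = 0` or if `a_v` is a
`v`-adic unit and `c_v` is `v`-integral, and `t_v = (1 - a_v)/c_v` (making the entry `1`)
otherwise; where `a_v, b_v, c_v, d_v` are integral (almost everywhere) `a_v d_v - b_v c_v = 1`
forces `a_v` or `c_v` to be a unit, so `t` is a finite adele and `a + tc` is everywhere non-zero
and almost everywhere a unit (Mathlib `FiniteAdeleRing.isUnit_iff`). [folklore] -/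
theorem FiniteAdeleRing.exists_isUnit_add_mul {a b c d : FiniteAdeleRing R K}
    (hdet : a * d - b * c = 1) : ∃ t : FiniteAdeleRing R K, IsUnit (a + t * c) := by
  classical
  -- the local recipe
  let f : ∀ v : HeightOneSpectrum R, v.adicCompletion K := fun v =>
    if c v = 0 then 0
    else if Valued.v (a v) = 1 ∧ Valued.v (c v) ≤ 1 then 0 else (1 - a v) / c v
  -- the determinant condition place by place
  have hdetv : ∀ v, a v * d v - b v * c v = 1 := fun v => by
    have := congrArg (fun x : FiniteAdeleRing R K => x v) hdet
    exact this
  -- where all entries are integral, `a_v` or `c_v` is a unit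
  have hint : ∀ᶠ v : HeightOneSpectrum R in Filter.cofinite,
      Valued.v (a v) ≤ 1 ∧ Valued.v (b v) ≤ 1 ∧ Valued.v (c v) ≤ 1 ∧ Valued.v (d v) ≤ 1 := by
    have h := fun x : FiniteAdeleRing R K => (x.2 : ∀ᶠ v in Filter.cofinite,
      x v ∈ v.adicCompletionIntegers K)
    filter_upwards [h a, h b, h c, h d] with v ha hb hc hd
    exact ⟨(mem_adicCompletionIntegers R K v).1 ha, (mem_adicCompletionIntegers R K v).1 hb,
      (mem_adicCompletionIntegers R K v).1 hc, (mem_adicCompletionIntegers R K v).1 hd⟩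
  have hunit : ∀ v, Valued.v (a v) ≤ 1 → Valued.v (b v) ≤ 1 → Valued.v (c v) ≤ 1 →
      Valued.v (d v) ≤ 1 → Valued.v (c v) < 1 → Valued.v (a v) = 1 := by
    intro v ha hb hc hd hc1
    by_contra ha1
    have ha1' : Valued.v (a v) < 1 := lt_of_le_of_ne ha ha1
    have h1 : Valued.v (a v * d v - b v * c v) < 1 := by
      refine lt_of_le_of_lt (Valuation.map_sub _ _ _) (max_lt ?_ ?_)
      · rw [Valuation.map_mul]
        calc Valued.v (a v) * Valued.v (d v) ≤ Valued.v (a v) * 1 := by gcongr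
          _ < 1 := by simpa using ha1'
      · rw [Valuation.map_mul]
        calc Valued.v (b v) * Valued.v (c v) ≤ 1 * Valued.v (c v) := by gcongr
          _ < 1 := by simpa using hc1
    rw [hdetv v, Valuation.map_one] at h1
    exact lt_irrefl _ h1
  -- `t` is a finite adele
  have hf : ∀ᶠ v : HeightOneSpectrum R in Filter.cofinite, f v ∈ v.adicCompletionIntegers K := by
    filter_upwards [hint] with v hv
    obtain ⟨ha, hb, hc, hd⟩ := hv
    rw [mem_adicCompletionIntegers]
    simp only [f]
    split_ifs with h0 h1
    · simp
    · simp
    · -- here `c_v ≠ 0` and `a_v` is not a unit, so `c_v` is a unit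
      have hc1 : Valued.v (c v) = 1 := by
        by_contra hc1
        exact h1 ⟨hunit v ha hb hc hd (lt_of_le_of_ne hc hc1), hc⟩
      rw [map_div₀, hc1, div_one]
      exact le_trans (Valuation.map_sub _ _ _) (max_le (by simp) ha)
  let t : FiniteAdeleRing R K := ⟨f, hf⟩
  refine ⟨t, ?_⟩
  rw [FiniteAdeleRing.isUnit_iff]
  have hcoord : ∀ v, (a + t * c) v = a v + f v * c v := fun v => rfl
  constructor
  · intro v
    rw [hcoord]
    simp only [f]
    split_ifs with h0 h1
    · -- `c_v = 0`: `a_v d_v = 1`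
      have := hdetv v
      rw [h0, mul_zero, sub_zero] at this
      rw [zero_mul, add_zero]
      exact left_ne_zero_of_mul_eq_one this
    · rw [zero_mul, add_zero]
      intro ha0
      rw [ha0, Valuation.map_zero] at h1
      exact zero_ne_one h1.1
    · rw [div_mul_cancel₀ _ h0, add_sub_cancel]
      exact one_ne_zero
  · filter_upwards [hint] with v hv
    obtain ⟨ha, hb, hc, hd⟩ := hv
    rw [hcoord]
    simp only [f]
    split_ifs with h0 h1
    · -- `c_v = 0`: `a_v d_v = 1` with both integral, so `a_v` is a unit
      rw [zero_mul, add_zero]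
      refine hunit v ha hb hc hd ?_
      rw [h0, Valuation.map_zero]
      exact zero_lt_one
    · rw [zero_mul, add_zero]
      exact h1.1
    · rw [div_mul_cancel₀ _ h0, add_sub_cancel, Valuation.map_one]

end Adelic

/-! ### Strong approximation -/

section StrongApproximation

variable (R : Type*) [CommRing R] [IsDedekindDomain R] (K : Type*) [Field K] [Algebra R K]
  [IsFractionRing R K]

/-- The elementary unipotents `u^±(x)`, `x ∈ 𝔸_K^∞`, lie in the closure of the image of `SL₂(K)`
in `SL₂(𝔸_K^∞)`: `x ↦ u^±(x)` is continuous, `u^±(K)` consists of images of elements of `SL₂(K)`,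
and `K` is dense in `𝔸_K^∞` (`denseRange_algebraMap_finiteAdeleRing`). [folklore] -/
theorem transvection_mem_topologicalClosure_range {i j : Fin 2} (hij : i ≠ j)
    (x : FiniteAdeleRing R K) :
    transvection hij x ∈ ((map (algebraMap K (FiniteAdeleRing R K)) :
      SL(2, K) →* SL(2, FiniteAdeleRing R K)).range).topologicalClosure := by
  have hcont := continuous_transvection (A := FiniteAdeleRing R K) hij
  have hx : x ∈ closure (Set.range (algebraMap K (FiniteAdeleRing R K))) := by
    rw [(denseRange_algebraMap_finiteAdeleRing R K).closure_range]
    exact Set.mem_univ x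
  have h := image_closure_subset_closure_image hcont ⟨x, hx, rfl⟩
  rw [← SetLike.mem_coe, Subgroup.topologicalClosure_coe]
  refine closure_mono ?_ h
  rintro _ ⟨_, ⟨k, rfl⟩, rfl⟩
  exact ⟨transvection hij k, map_transvection _ hij k⟩

/-- **Strong approximation for `SL₂` (finite adeles): `SL₂(K)` is dense in `SL₂(𝔸_K^∞)`** for the
fraction field `K` of a Dedekind domain `R` (Kneser, Platonov: Platonov–Rapinchuk (1994),
Thm. 7.12, the case `G = SL₂`, `S ⊇` the archimedean places; Bump (1997), Thm. 3.3.1 for `ℚ`).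
Proof: the closure `H` of the image is a subgroup containing all `u^±(x)`
(`transvection_mem_topologicalClosure_range`), and every `g ∈ SL₂(𝔸_K^∞)` is a product of
elementary unipotents (`FiniteAdeleRing.exists_isUnit_add_mul`, `mem_of_isUnit_apply_add_mul`).
[cite: PlatonovRapinchuk1994, Thm. 7.12] [cite: Bump1997, Thm. 3.3.1] -/
theorem denseRange_specialLinearGroup_map_finiteAdeleRing :
    DenseRange (map (algebraMap K (FiniteAdeleRing R K)) :
      SL(2, K) → SL(2, FiniteAdeleRing R K)) := by
  set φ : SL(2, K) →* SL(2, FiniteAdeleRing R K) := map (algebraMap K (FiniteAdeleRing R K))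
  have htop : φ.range.topologicalClosure = ⊤ := by
    rw [eq_top_iff]
    intro g _
    have hdet : g 0 0 * g 1 1 - g 0 1 * g 1 0 = 1 := by
      have := g.2
      rw [Matrix.det_fin_two] at this
      exact this
    obtain ⟨t, ht⟩ := FiniteAdeleRing.exists_isUnit_add_mul hdet
    exact mem_of_isUnit_apply_add_mul _
      (fun x => transvection_mem_topologicalClosure_range R K (by decide) x)
      (fun x => transvection_mem_topologicalClosure_range R K (by decide) x) g ht
  have h : closure (Set.range φ) = Set.univ := by
    rw [← MonoidHom.coe_range, ← Subgroup.topologicalClosure_coe, htop, Subgroup.coe_top]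
  exact dense_iff_closure_eq.2 h

/-- **`SL₂(𝔸_K^∞) = SL₂(K) · U` for every open subgroup `U`** (the working form of strong
approximation: Gelbart (1975), (3.1); Bump (1997), Thm. 3.3.1 and its proof): for
`g ∈ SL₂(𝔸_K^∞)` the open set `g U⁻¹ ∋ g` meets the dense image of `SL₂(K)`.
[cite: Bump1997, Thm. 3.3.1] [cite: PlatonovRapinchuk1994, Thm. 7.12] -/
theorem exists_specialLinearGroup_map_mul_eq (U : Subgroup SL(2, FiniteAdeleRing R K))
    (hU : IsOpen (U : Set SL(2, FiniteAdeleRing R K))) (g : SL(2, FiniteAdeleRing R K)) :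
    ∃ (γ : SL(2, K)) (u : SL(2, FiniteAdeleRing R K)), u ∈ U ∧
      map (algebraMap K (FiniteAdeleRing R K)) γ * u = g := by
  have hopen : IsOpen {x : SL(2, FiniteAdeleRing R K) | x⁻¹ * g ∈ U} :=
    hU.preimage ((continuous_inv).mul continuous_const)
  obtain ⟨γ, hγ⟩ :=
    (denseRange_specialLinearGroup_map_finiteAdeleRing R K).exists_mem_open hopen
      ⟨g, by simp [U.one_mem]⟩
  exact ⟨γ, _, hγ, mul_inv_cancel_left _ _⟩

end StrongApproximation

end Literature.NumberTheory.Automorphic
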